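import Mathlib.Analysis.SpecialFunctions.Integrals.Basic
import Literature.Probability.RandomPlanarGeometry.ConformalRemovabilityRadial
import HarnessLib

/-!
# Conformal removability: boundaries of Hölder domains are uniformly mean porous

Support for the proof of `JonesSmirnov2000_frontier_of_isHolderDomain` (Jones–Smirnov 2000,
Cor. 2; `ConformalRemovability.lean`). P. Koskela and S. Rohde (*Hausdorff dimension and mean
porosity*, Math. Ann. 309 (1997) 593–609, §5) observed that the quasihyperbolic boundary
condition of a Hölder domain makes its boundary MEAN POROUS; combined with
`volume_thickening_le_of_meanPorous` (`ConformalRemovabilityMeanPorous.lean`) this replaces the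
appeal to [JM] = Jones–Makarov in Jones–Smirnov's proof of Cor. 2 (p. 267). This file proves mean
porosity in the exact form consumed there, by an elementary argument along the radii of the
Riemann map `φ` (inputs from `ConformalRemovabilityRadial.lean`):

Fix `ξ ∈ ∂Ω` and a radius `γ(s) = φ(sζ)` landing at `ξ` with `|γ(s) - ξ| ≤ C(1-s)^α`. For the
thresholds `ρ_k = 2^{-k}/4` let `a_k` be the LAST parameter with `|γ(a_k) - ξ| = 2ρ_k`
(`exists_isLast_ge`). On `[a_k, a_{k+1}]` the curve stays within `2ρ_k` of `ξ` and travels at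
least `ρ_k`, so if the distance to the boundary stays `< η'ρ_k` there ("scale `k` is not porous")
the quasihyperbolic length `∫ |γ'|/dist(γ, ∂Ω)` of this piece is `≥ 1/η'`. By Koebe
(`le_infDist_of_conformalEquiv_ball`) the quasihyperbolic length of `γ|[0, a_{n+1}]` is at most
`128π log(1/(1 - a_{n+1})) ≤ (128π/α)(log C + (n+2) log 2)`. Hence at most `≈ n/4` of the scales
`k ≤ n` are non-porous once `η' ≈ α/(512π log 2)`, and a porous scale `k` yields a disc
`B(γ(s), η'ρ_k) ⊆ Ω ∩ B(ξ, 2^{-k})`.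

* `exists_isLast_ge` — the last parameter at which a continuous function on `[0,1)` is `≥ θ`;
* `hasDerivAt_radial`, `norm_sub_radial_le_integral`, … — calculus along a radius;
* `meanPorous_frontier_of_holderOnWith` — MAIN: `∂Ω` is uniformly mean porous with proportion
  `1/2`, in the hypothesis format of `volume_thickening_le_of_meanPorous`.

## References

* P. Koskela, S. Rohde, Math. Ann. 309 (1997) 593–609, §5 (mean porosity from the
  quasihyperbolic boundary condition); proof here [folklore]/elementary.
* [JonesSmirnov2000] P. W. Jones, S. K. Smirnov, Ark. Mat. 38 (2000) 263–279, Cor. 2 (p. 267).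
-/

noncomputable section

open Set Filter Metric Complex intervalIntegral
open scoped Topology NNReal

namespace Literature.Probability.RandomPlanarGeometry

/-! ### The last parameter at which a continuous function is large -/

/-- **Last exit.** Let `g` be continuous on `[0, 1)`, `θ ≤ g 0`, and `g < θ` on `(R, 1)` for some
`0 ≤ R < 1`. Then there is a last parameter `a ∈ [0, R]` with `g a = θ`: `g < θ` on `(a, 1)`.
[folklore] -/
theorem exists_isLast_ge {g : ℝ → ℝ} {R θ : ℝ} (hg : ContinuousOn g (Ico 0 1)) (hR0 : 0 ≤ R)
    (hR1 : R < 1) (h0 : θ ≤ g 0) (hlt : ∀ s, R < s → s < 1 → g s < θ) :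
    ∃ a ∈ Icc 0 R, g a = θ ∧ ∀ s, a < s → s < 1 → g s < θ := by
  set S : Set ℝ := Icc 0 R ∩ g ⁻¹' Ici θ with hS
  have hSc : IsClosed S :=
    (hg.mono (Icc_subset_Ico_right hR1)).preimage_isClosed_of_isClosed isClosed_Icc isClosed_Ici
  have hScomp : IsCompact S := isCompact_Icc.of_isClosed_subset hSc inter_subset_left
  have h0S : (0 : ℝ) ∈ S := ⟨⟨le_rfl, hR0⟩, h0⟩
  set a := sSup S with ha
  have haS : a ∈ S := hScomp.sSup_mem ⟨0, h0S⟩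
  obtain ⟨⟨ha0, haR⟩, haθ⟩ := haS
  have hafter : ∀ s, a < s → s < 1 → g s < θ := by
    intro s has hs1
    by_cases hsR : s ≤ R
    · by_contra h
      have hsS : s ∈ S := ⟨⟨ha0.trans has.le, hsR⟩, not_lt.1 h⟩
      exact (le_csSup hScomp.bddAbove hsS).not_gt has
    · exact hlt s (not_le.1 hsR) hs1
  refine ⟨a, ⟨ha0, haR⟩, le_antisymm ?_ haθ, hafter⟩
  -- `g a ≤ θ` by continuity from the right
  have ha1 : a < 1 := haR.trans_lt hR1
  have hcont : ContinuousWithinAt g (Ico 0 1) a := hg a ⟨ha0, ha1⟩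
  have hcont' : Tendsto g (𝓝[Ioo a 1] a) (𝓝 (g a)) :=
    hcont.tendsto.mono_left (nhdsWithin_mono a fun s hs => ⟨ha0.trans hs.1.le, hs.2⟩)
  haveI : (𝓝[Ioo a 1] a).NeBot := by
    rw [nhdsWithin_Ioo_eq_nhdsGT ha1]
    infer_instance
  refine le_of_tendsto hcont' ?_
  filter_upwards [self_mem_nhdsWithin] with s hs
  exact (hafter s hs.1 hs.2).le

/-! ### Calculus along a radius of the Riemann map -/

section Radial

variable {Ω : Set ℂ}

/-- The radius `s ↦ φ(sζ)` is differentiable with derivative `φ'(sζ) ζ` for `|s| < 1`.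
[folklore] -/
theorem hasDerivAt_radial (φ : ConformalEquiv (ball (0 : ℂ) 1) Ω) {ζ : ℂ} (hζ : ‖ζ‖ = 1) {s : ℝ}
    (hs : |s| < 1) : HasDerivAt (fun s : ℝ => φ (s * ζ)) (deriv φ (s * ζ) * ζ) s := by
  have hmem : (s : ℂ) * ζ ∈ ball (0 : ℂ) 1 := by
    rw [mem_ball_zero_iff, norm_mul, Complex.norm_real, Real.norm_eq_abs, hζ, mul_one]
    exact hs
  have hφ : HasDerivAt φ (deriv φ (s * ζ)) (s * ζ) :=
    (φ.differentiableOn_coe.differentiableAt (isOpen_ball.mem_nhds hmem)).hasDerivAt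
  have hlin : HasDerivAt (fun w : ℂ => w * ζ) ζ (s : ℂ) := by
    simpa using (hasDerivAt_id (s : ℂ)).mul_const ζ
  have := hφ.comp (s : ℂ) hlin
  exact this.comp_ofReal

/-- The radius is continuous on `(-1, 1)`. [folklore] -/
theorem continuousOn_radial (φ : ConformalEquiv (ball (0 : ℂ) 1) Ω) {ζ : ℂ} (hζ : ‖ζ‖ = 1) :
    ContinuousOn (fun s : ℝ => φ (s * ζ)) (Ioo (-1) 1) := fun _ hs =>
  (hasDerivAt_radial φ hζ (abs_lt.2 hs)).continuousAt.continuousWithinAt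

/-- The speed of the radius is continuous on `(-1, 1)`. [folklore] -/
theorem continuousOn_deriv_radial (φ : ConformalEquiv (ball (0 : ℂ) 1) Ω) {ζ : ℂ} (hζ : ‖ζ‖ = 1) :
    ContinuousOn (fun s : ℝ => deriv φ (s * ζ) * ζ) (Ioo (-1) 1) := by
  have hd : ContinuousOn (deriv φ) (ball (0 : ℂ) 1) :=
    (φ.differentiableOn_coe.analyticOnNhd isOpen_ball).deriv.continuousOn
  refine (hd.comp (by fun_prop) fun s hs => ?_).mul continuousOn_const
  rw [mem_ball_zero_iff, norm_mul, Complex.norm_real, Real.norm_eq_abs, hζ, mul_one]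
  exact abs_lt.2 hs

/-- **The radius travels at most its length**: `|γ(b) - γ(a)| ≤ ∫_a^b |γ'|` for
`0 ≤ a ≤ b < 1`. [folklore] -/
theorem norm_sub_radial_le_integral (φ : ConformalEquiv (ball (0 : ℂ) 1) Ω) {ζ : ℂ}
    (hζ : ‖ζ‖ = 1) {a b : ℝ} (ha : 0 ≤ a) (hab : a ≤ b) (hb : b < 1) :
    ‖φ (b * ζ) - φ (a * ζ)‖ ≤ ∫ s in a..b, ‖deriv φ (s * ζ) * ζ‖ := by
  have hsub : Icc a b ⊆ Ioo (-1 : ℝ) 1 := fun s hs => ⟨by linarith [hs.1], by linarith [hs.2]⟩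
  have hftc : ∫ s in a..b, deriv φ (s * ζ) * ζ = φ (b * ζ) - φ (a * ζ) :=
    integral_eq_sub_of_hasDerivAt_of_le hab ((continuousOn_radial φ hζ).mono hsub)
      (fun s hs => hasDerivAt_radial φ hζ (abs_lt.2 ⟨by linarith [hs.1], by linarith [hs.2]⟩))
      (((continuousOn_deriv_radial φ hζ).mono (by rwa [uIcc_of_le hab])).intervalIntegrable)
  rw [← hftc]
  exact norm_integral_le_integral_norm hab

/-- **Koebe along the radius**: the quasihyperbolic density satisfies
`|φ'(sζ)| / dist(φ(sζ), Ωᶜ) ≤ 128π / (1 - s)` for `0 ≤ s < 1`. [folklore] -/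
theorem density_radial_le (φ : ConformalEquiv (ball (0 : ℂ) 1) Ω) (hΩ : Ωᶜ.Nonempty) {ζ : ℂ}
    (hζ : ‖ζ‖ = 1) {s : ℝ} (hs0 : 0 ≤ s) (hs1 : s < 1) :
    ‖deriv φ (s * ζ) * ζ‖ / infDist (φ (s * ζ)) Ωᶜ ≤ 128 * Real.pi / (1 - s) := by
  have hmem := ofReal_mul_mem_ball hζ hs0 hs1
  have hK := le_infDist_of_conformalEquiv_ball φ hmem hΩ
  rw [norm_mul, Complex.norm_real, Real.norm_of_nonneg hs0, hζ, mul_one] at hK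
  have hpos : 0 < infDist (φ (s * ζ)) Ωᶜ := by
    rw [← infDist_pos_iff_notMem_closure hΩ, (isOpen_of_conformalEquiv_ball φ).isClosed_compl.closure_eq]
    exact fun h => h (φ.mapsTo hmem)
  rw [norm_mul, hζ, mul_one, div_le_div_iff₀ hpos (by linarith)]
  have := (div_le_iff₀ (by positivity : (0 : ℝ) < 128 * Real.pi)).1 hK
  nlinarith

/-- The quasihyperbolic density along the radius is continuous on `(-1, 1)`. [folklore] -/
theorem continuousOn_density_radial (φ : ConformalEquiv (ball (0 : ℂ) 1) Ω) (hΩ : Ωᶜ.Nonempty)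
    {ζ : ℂ} (hζ : ‖ζ‖ = 1) :
    ContinuousOn (fun s : ℝ => ‖deriv φ (s * ζ) * ζ‖ / infDist (φ (s * ζ)) Ωᶜ) (Ioo (-1) 1) := by
  refine (continuousOn_deriv_radial φ hζ).norm.div
    ((continuous_infDist_pt _).comp_continuousOn (continuousOn_radial φ hζ)) fun s hs => ?_
  have hmem : (s : ℂ) * ζ ∈ ball (0 : ℂ) 1 := by
    rw [mem_ball_zero_iff, norm_mul, Complex.norm_real, Real.norm_eq_abs, hζ, mul_one]
    exact abs_lt.2 hs
  have hpos : 0 < infDist (φ (s * ζ)) Ωᶜ := by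
    rw [← infDist_pos_iff_notMem_closure hΩ, (isOpen_of_conformalEquiv_ball φ).isClosed_compl.closure_eq]
    exact fun h => h (φ.mapsTo hmem)
  exact hpos.ne'

/-- `∫_0^a 1/(1-s) ds = log (1/(1-a))` for `a < 1`. [folklore] -/
theorem integral_inv_one_sub {a : ℝ} (ha1 : a < 1) :
    ∫ s in (0 : ℝ)..a, 1 / (1 - s) = Real.log (1 / (1 - a)) := by
  have h := intervalIntegral.integral_comp_sub_left (fun x : ℝ => x⁻¹) (a := 0) (b := a) 1
  simp only [one_div] at *
  rw [h, sub_zero, integral_inv_of_pos (by linarith) one_pos, one_div]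

end Radial

/-! ### Mean porosity of the boundary -/

section MeanPorous

variable {Ω : Set ℂ}

open scoped Classical in
/-- **Boundaries of Hölder domains are uniformly mean porous** (Koskela–Rohde 1997, §5; here
from Koebe's theorem along radii). Let `φ : 𝔻 → Ω` be a conformal equivalence, Hölder continuous
with exponent `α > 0`. Then there are `η > 0`, `k₁ ≥ 4` and `n₀` such that for every `ξ ∈ ∂Ω` and
`n ≥ n₀`, at least `n/2` of the scales `k ∈ [k₁, n]` are porous at `ξ`: some disc
`B(w, η 2^{-k}) ⊆ B(ξ, 2^{-k})` is disjoint from `∂Ω`. [folklore] -/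
theorem meanPorous_frontier_of_holderOnWith (φ : ConformalEquiv (ball (0 : ℂ) 1) Ω) {C α : ℝ≥0}
    (hα : 0 < α) (hH : HolderOnWith C α φ (ball (0 : ℂ) 1)) :
    ∃ (η : ℝ) (k₁ n₀ : ℕ), 0 < η ∧ 4 ≤ k₁ ∧ ∀ ξ ∈ frontier Ω, ∀ n : ℕ, n₀ ≤ n →
      (1 / 2 : ℝ) * n ≤ (((Finset.Icc k₁ n).filter fun k => ∃ w : ℂ,
        ball w (η / 2 ^ k) ⊆ ball ξ (1 / 2 ^ k) ∧ Disjoint (ball w (η / 2 ^ k)) (frontier Ω)).card : ℝ) := by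
  classical
  -- constants
  have hΩo := isOpen_of_conformalEquiv_ball φ
  have hΩc : Ωᶜ.Nonempty := compl_nonempty_of_holderOnWith φ hH
  have hαr : (0 : ℝ) < α := by exact_mod_cast hα
  set K : ℝ := 128 * Real.pi with hK
  have hK0 : 0 < K := by positivity
  set C' : ℝ := max (C : ℝ) 1 with hC'
  have hC'1 : 1 ≤ C' := le_max_right _ _
  have hC'0 : 0 < C' := by linarith
  have hCC' : (C : ℝ) ≤ C' := le_max_left _ _
  have hlog2 : 0 < Real.log 2 := Real.log_pos one_lt_two
  set d₀ : ℝ := infDist (φ 0) Ωᶜ with hd₀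
  have hd₀pos : 0 < d₀ := by
    rw [hd₀, ← infDist_pos_iff_notMem_closure hΩc, hΩo.isClosed_compl.closure_eq]
    exact fun h => h (φ.mapsTo (mem_ball_self one_pos))
  obtain ⟨k₀, hk₀⟩ := pow_unbounded_of_one_lt (1 / d₀) (one_lt_two (α := ℝ))
  have hk₀' : (1 : ℝ) / 2 ^ k₀ < d₀ := by
    rw [div_lt_iff₀ (by positivity)]
    rw [div_lt_iff₀ hd₀pos] at hk₀
    linarith
  set k₁ : ℕ := max k₀ 4 with hk₁
  set η' : ℝ := min 1 ((α : ℝ) / (4 * K * Real.log 2)) with hη'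
  have hη'0 : 0 < η' := lt_min one_pos (by positivity)
  have hη'1 : η' ≤ 1 := min_le_left _ _
  have hη'2 : η' ≤ (α : ℝ) / (4 * K * Real.log 2) := min_le_right _ _
  set c₀ : ℝ := Real.log C' / (4 * Real.log 2) with hc₀
  have hc₀0 : 0 ≤ c₀ := div_nonneg (Real.log_nonneg hC'1) (by positivity)
  set n₀ : ℕ := ⌈4 * ((k₁ : ℝ) + c₀)⌉₊ with hn₀
  refine ⟨η' / 4, k₁, n₀, by positivity, le_max_right _ _, fun ξ hξ n hn => ?_⟩
  -- the radius landing at `ξ`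
  obtain ⟨ζ, hζ, hrad⟩ := exists_radial_of_mem_frontier φ hα hH hξ
  have hrad' : ∀ r : ℝ, 0 ≤ r → r < 1 → dist (φ (r * ζ)) ξ ≤ C' * (1 - r) ^ (α : ℝ) := fun r hr0 hr1 =>
    (hrad r hr0 hr1).trans (mul_le_mul_of_nonneg_right hCC' (Real.rpow_nonneg (by linarith) _))
  have hξΩ : ξ ∉ Ω := by
    rw [hΩo.frontier_eq] at hξ
    exact hξ.2
  have hξc : ξ ∈ closure Ω := frontier_subset_closure hξ
  -- the distance function along the radius
  set g : ℝ → ℝ := fun s => dist (φ (s * ζ)) ξ with hg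
  have hgc : ContinuousOn g (Ico 0 1) :=
    ((continuous_id.dist continuous_const).comp_continuousOn (continuousOn_radial φ hζ)).mono
      fun s hs => ⟨by linarith [hs.1], hs.2⟩
  have hg0 : d₀ ≤ g 0 := by
    simp only [hg, Complex.ofReal_zero, zero_mul]
    exact infDist_le_dist_of_mem hξΩ
  -- the last parameters `A j` at which `g = 1/2^j`, for `j ≥ k₀`
  have hex : ∀ j : ℕ, ∃ a : ℝ, k₀ ≤ j →
      (a ∈ Ico (0 : ℝ) 1 ∧ g a = 1 / 2 ^ j ∧ ∀ s, a < s → s < 1 → g s < 1 / 2 ^ j) := by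
    intro j
    by_cases hj : k₀ ≤ j
    · have hθ : (0 : ℝ) < 1 / 2 ^ j := by positivity
      -- beyond `R` the curve is within `θ/2` of `ξ`
      set R : ℝ := 1 - ((1 / 2 ^ j) / (2 * C')) ^ (1 / (α : ℝ)) with hR
      have hq0 : 0 < (1 / 2 ^ j) / (2 * C') := by positivity
      have hq1 : (1 / 2 ^ j) / (2 * C') ≤ 1 := by
        rw [div_le_one (by positivity)]
        have : (1 : ℝ) / 2 ^ j ≤ 1 := by
          rw [div_le_one (by positivity)]; exact one_le_pow₀ (by norm_num)
        linarith
      have hR1 : R < 1 := by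
        rw [hR]; linarith [Real.rpow_pos_of_pos hq0 (1 / (α : ℝ))]
      have hR0 : 0 ≤ R := by
        rw [hR, sub_nonneg]
        exact Real.rpow_le_one hq0.le hq1 (by positivity)
      have hθj : (1 : ℝ) / 2 ^ j ≤ g 0 := by
        refine le_trans ?_ hg0
        refine le_trans ?_ hk₀'.le
        exact one_div_le_one_div_of_le (by positivity) (pow_le_pow_right₀ one_le_two hj)
      have hlt : ∀ s, R < s → s < 1 → g s < 1 / 2 ^ j := by
        intro s hRs hs1
        have hs0 : 0 ≤ s := hR0.trans hRs.le
        calc g s ≤ C' * (1 - s) ^ (α : ℝ) := hrad' s hs0 hs1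
          _ < C' * (1 - R) ^ (α : ℝ) := by gcongr
          _ = (1 / 2 ^ j) / 2 := by
              rw [hR, sub_sub_cancel, ← Real.rpow_mul hq0.le, one_div_mul_cancel hαr.ne', Real.rpow_one]
              field_simp
          _ < 1 / 2 ^ j := by linarith
      obtain ⟨a, ⟨ha0, haR⟩, hga, hafter⟩ := exists_isLast_ge hgc hR0 hR1 hθj hlt
      exact ⟨a, fun _ => ⟨⟨ha0, haR.trans_lt hR1⟩, hga, hafter⟩⟩
    · exact ⟨0, fun h => (hj h).elim⟩
  choose A hA using hex
  have hk₁k₀ : k₀ ≤ k₁ := le_max_left _ _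
  -- monotonicity of `A`
  have hAmono : ∀ j j', k₀ ≤ j → j ≤ j' → A j ≤ A j' := by
    intro j j' hj hjj'
    obtain ⟨hAj, hgj, -⟩ := hA j hj
    obtain ⟨hAj', -, hafter'⟩ := hA j' (hj.trans hjj')
    by_contra h
    have h1 := hafter' (A j) (not_le.1 h) hAj.2
    rw [hgj] at h1
    have h2 : (1 : ℝ) / 2 ^ j' ≤ 1 / 2 ^ j :=
      one_div_le_one_div_of_le (by positivity) (pow_le_pow_right₀ one_le_two hjj')
    linarith
  -- the quasihyperbolic density along the radius and its integrability
  set f : ℝ → ℝ := fun s => ‖deriv φ (s * ζ) * ζ‖ / infDist (φ (s * ζ)) Ωᶜ with hf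
  have hfc : ContinuousOn f (Ioo (-1) 1) := continuousOn_density_radial φ hΩc hζ
  have hf0 : ∀ s, 0 ≤ f s := fun s => div_nonneg (norm_nonneg _) infDist_nonneg
  have hfi : ∀ a b : ℝ, 0 ≤ a → a ≤ b → b < 1 → IntervalIntegrable f MeasureTheory.volume a b :=
    fun a b ha hab hb => (hfc.mono (by
      rw [uIcc_of_le hab]; exact fun s hs => ⟨by linarith [hs.1], by linarith [hs.2]⟩)).intervalIntegrable
  -- KEY STEP: a non-porous scale costs quasihyperbolic length `≥ 1/η'`
  have hkey : ∀ k ∈ Finset.Icc k₁ n,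
      (∃ w : ℂ, ball w (η' / 4 / 2 ^ k) ⊆ ball ξ (1 / 2 ^ k) ∧ Disjoint (ball w (η' / 4 / 2 ^ k)) (frontier Ω)) ∨
      1 / η' ≤ ∫ s in A (k + 1)..A (k + 2), f s := by
    intro k hk
    rw [Finset.mem_Icc] at hk
    have hk1 : k₀ ≤ k + 1 := by omega
    have hk2 : k₀ ≤ k + 2 := by omega
    obtain ⟨hA1, hg1, hafter1⟩ := hA (k + 1) hk1
    obtain ⟨hA2, hg2, -⟩ := hA (k + 2) hk2
    have hA12 : A (k + 1) ≤ A (k + 2) := hAmono _ _ hk1 (by omega)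
    have hρ : η' / 4 / 2 ^ k = η' / 2 ^ (k + 2) := by rw [pow_add]; ring
    -- on `[A (k+1), A (k+2)]` the curve is within `1/2^(k+1)` of `ξ`
    have hnear : ∀ s ∈ Icc (A (k + 1)) (A (k + 2)), g s ≤ 1 / 2 ^ (k + 1) := by
      intro s hs
      rcases hs.1.lt_or_eq with hlt | heq
      · exact (hafter1 s hlt (hs.2.trans_lt hA2.2)).le
      · rw [← heq, hg1]
    by_cases hpor : ∃ s ∈ Icc (A (k + 1)) (A (k + 2)), η' / 2 ^ (k + 2) ≤ infDist (φ (s * ζ)) Ωᶜ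
    · -- a porous scale
      left
      obtain ⟨s, hs, hsd⟩ := hpor
      refine ⟨φ (s * ζ), ?_, ?_⟩
      · intro z hz
        rw [mem_ball] at hz ⊢
        rw [hρ] at hz
        have h1 : dist z ξ ≤ dist z (φ (s * ζ)) + g s := dist_triangle _ _ _
        have h2 := hnear s hs
        have h3 : η' / 2 ^ (k + 2) + 1 / 2 ^ (k + 1) < 1 / 2 ^ k := by
          have hp : (0 : ℝ) < 2 ^ (k + 2) := by positivity
          have e1 : (1 : ℝ) / 2 ^ (k + 1) = 2 / 2 ^ (k + 2) := by
            rw [pow_succ 2 (k + 1)]; field_simp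
          have e2 : (1 : ℝ) / 2 ^ k = 4 / 2 ^ (k + 2) := by
            rw [pow_add]; field_simp; norm_num
          rw [e1, e2, ← add_div, div_lt_div_iff_of_pos_right hp]
          linarith
        linarith
      · rw [hρ]
        refine Set.disjoint_left.2 fun z hz hzf => ?_
        have hzΩ : z ∈ Ω := ball_infDist_compl_subset (x := φ (s * ζ)) (s := Ω)
          (ball_subset_ball hsd hz)
        rw [hΩo.frontier_eq] at hzf
        exact hzf.2 hzΩ
    · -- a non-porous scale: quasihyperbolic length `≥ 1/η'`
      right
      push Not at hpor
      have hA10 : 0 ≤ A (k + 1) := hA1.1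
      have hA21 : A (k + 2) < 1 := hA2.2
      -- travel `≥ 1/2^(k+2)`
      have htravel : (1 : ℝ) / 2 ^ (k + 2) ≤ ∫ s in A (k + 1)..A (k + 2), ‖deriv φ (s * ζ) * ζ‖ := by
        have h1 := norm_sub_radial_le_integral φ hζ hA10 hA12 hA21
        have h2 : g (A (k + 1)) - g (A (k + 2)) ≤ ‖φ (A (k + 2) * ζ) - φ (A (k + 1) * ζ)‖ := by
          simp only [hg]
          have t := dist_triangle (φ (↑(A (k + 1)) * ζ)) (φ (↑(A (k + 2)) * ζ)) ξ
          have e : dist (φ (↑(A (k + 1)) * ζ)) (φ (↑(A (k + 2)) * ζ)) =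
              ‖φ (↑(A (k + 2)) * ζ) - φ (↑(A (k + 1)) * ζ)‖ := by rw [dist_comm, dist_eq_norm]
          rw [e] at t
          linarith
        rw [hg1, hg2] at h2
        have h3 : (1 : ℝ) / 2 ^ (k + 1) - 1 / 2 ^ (k + 2) = 1 / 2 ^ (k + 2) := by
          rw [pow_succ, pow_succ]; field_simp; ring
        linarith
      -- the density dominates `(2^(k+2)/η') |γ'|`
      have hdens : ∀ s ∈ Icc (A (k + 1)) (A (k + 2)),
          (2 ^ (k + 2) / η') * ‖deriv φ (s * ζ) * ζ‖ ≤ f s := by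
        intro s hs
        have hd := hpor s hs
        have hdpos : 0 < infDist (φ (s * ζ)) Ωᶜ := by
          rw [← infDist_pos_iff_notMem_closure hΩc, hΩo.isClosed_compl.closure_eq]
          exact fun h => h (φ.mapsTo (ofReal_mul_mem_ball hζ (hA10.trans hs.1) (hs.2.trans_lt hA21)))
        simp only [hf]
        rw [le_div_iff₀ hdpos]
        have hn : 0 ≤ ‖deriv φ (s * ζ) * ζ‖ := norm_nonneg _
        calc 2 ^ (k + 2) / η' * ‖deriv φ (↑s * ζ) * ζ‖ * infDist (φ (↑s * ζ)) Ωᶜ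
            ≤ 2 ^ (k + 2) / η' * ‖deriv φ (↑s * ζ) * ζ‖ * (η' / 2 ^ (k + 2)) := by gcongr
          _ = ‖deriv φ (↑s * ζ) * ζ‖ := by field_simp
      calc 1 / η' = (2 ^ (k + 2) / η') * (1 / 2 ^ (k + 2)) := by field_simp
        _ ≤ (2 ^ (k + 2) / η') * ∫ s in A (k + 1)..A (k + 2), ‖deriv φ (s * ζ) * ζ‖ := by gcongr
        _ = ∫ s in A (k + 1)..A (k + 2), (2 ^ (k + 2) / η') * ‖deriv φ (s * ζ) * ζ‖ := by
            rw [intervalIntegral.integral_const_mul]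
        _ ≤ ∫ s in A (k + 1)..A (k + 2), f s := by
            refine intervalIntegral.integral_mono_on hA12 ?_ (hfi _ _ hA10 hA12 hA21) hdens
            exact ((continuousOn_deriv_radial φ hζ).norm.mono (by
              rw [uIcc_of_le hA12]
              exact fun s hs => ⟨by linarith [hs.1], by linarith [hs.2, hA21]⟩)).intervalIntegrable.const_mul _
  -- SUMMING: the non-porous scales cost at most the total quasihyperbolic length
  set P : Finset ℕ := (Finset.Icc k₁ n).filter fun k => ∃ w : ℂ,
    ball w (η' / 4 / 2 ^ k) ⊆ ball ξ (1 / 2 ^ k) ∧ Disjoint (ball w (η' / 4 / 2 ^ k)) (frontier Ω) with hP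
  set NP : Finset ℕ := (Finset.Icc k₁ n).filter fun k => ¬ ∃ w : ℂ,
    ball w (η' / 4 / 2 ^ k) ⊆ ball ξ (1 / 2 ^ k) ∧ Disjoint (ball w (η' / 4 / 2 ^ k)) (frontier Ω) with hNP
  have hcard : P.card + NP.card = (Finset.Icc k₁ n).card :=
    Finset.card_filter_add_card_filter_not _
  have hkn : k₁ ≤ n := by
    have : (n₀ : ℝ) ≤ n := by exact_mod_cast hn
    have h1 : 4 * ((k₁ : ℝ) + c₀) ≤ n₀ := Nat.le_ceil _
    have : (k₁ : ℝ) ≤ n := by nlinarith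
    exact_mod_cast this
  have hn2 : k₀ ≤ n + 2 := by omega
  obtain ⟨hAn, hgn, -⟩ := hA (n + 2) hn2
  have hsum1 : (NP.card : ℝ) * (1 / η') ≤ ∑ k ∈ Finset.Icc k₁ n, ∫ s in A (k + 1)..A (k + 2), f s := by
    calc (NP.card : ℝ) * (1 / η') = ∑ k ∈ NP, (1 / η') := by rw [Finset.sum_const, nsmul_eq_mul]
      _ ≤ ∑ k ∈ NP, ∫ s in A (k + 1)..A (k + 2), f s := by
          refine Finset.sum_le_sum fun k hk => ?_
          rw [hNP, Finset.mem_filter] at hk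
          rcases hkey k hk.1 with h | h
          · exact (hk.2 h).elim
          · exact h
      _ ≤ ∑ k ∈ Finset.Icc k₁ n, ∫ s in A (k + 1)..A (k + 2), f s := by
          refine Finset.sum_le_sum_of_subset_of_nonneg (Finset.filter_subset _ _) fun k hk _ => ?_
          rw [Finset.mem_Icc] at hk
          exact intervalIntegral.integral_nonneg (hAmono _ _ (by omega) (by omega)) fun s _ => hf0 s
  have hsum2 : ∑ k ∈ Finset.Icc k₁ n, ∫ s in A (k + 1)..A (k + 2), f s =
      ∫ s in A (k₁ + 1)..A (n + 2), f s := by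
    have h := intervalIntegral.sum_integral_adjacent_intervals_Ico (f := f) (μ := MeasureTheory.volume)
      (a := A) (m := k₁ + 1) (n := n + 2) (by omega) fun j hj => by
        obtain ⟨hj1, hj2⟩ := hj
        exact hfi _ _ (hA j (by omega)).1.1 (hAmono _ _ (by omega) (by omega)) (hA (j + 1) (by omega)).1.2
    rw [← h]
    refine (Finset.sum_nbij' (fun k => k + 1) (fun j => j - 1) (fun k hk => ?_) (fun j hj => ?_)
      (fun k hk => by omega) (fun j hj => ?_) (fun k hk => rfl))
    · rw [Finset.mem_Icc] at hk; rw [Finset.mem_Ico]; omega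
    · rw [Finset.mem_Ico] at hj; rw [Finset.mem_Icc]; omega
    · rw [Finset.mem_Ico] at hj; omega
  have hA10 : 0 ≤ A (k₁ + 1) := (hA (k₁ + 1) (by omega)).1.1
  have hA1n : A (k₁ + 1) ≤ A (n + 2) := hAmono _ _ (by omega) (by omega)
  have hsum3 : ∫ s in A (k₁ + 1)..A (n + 2), f s ≤ ∫ s in (0 : ℝ)..A (n + 2), f s := by
    have h := intervalIntegral.integral_interval_sub_left (hfi 0 _ le_rfl (hA10.trans hA1n) hAn.2)
      (hfi 0 _ le_rfl hA10 (hA1n.trans_lt hAn.2))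
    rw [← h]
    have : 0 ≤ ∫ x in (0 : ℝ)..A (k₁ + 1), f x :=
      intervalIntegral.integral_nonneg (μ := MeasureTheory.volume) hA10 fun s _ => hf0 s
    linarith
  have hsum4 : ∫ s in (0 : ℝ)..A (n + 2), f s ≤ K * Real.log (1 / (1 - A (n + 2))) := by
    calc ∫ s in (0 : ℝ)..A (n + 2), f s ≤ ∫ s in (0 : ℝ)..A (n + 2), K * (1 / (1 - s)) := by
          refine intervalIntegral.integral_mono_on hAn.1 (hfi 0 _ le_rfl hAn.1 hAn.2) ?_ fun s hs => ?_
          · refine (ContinuousOn.mul continuousOn_const (continuousOn_const.div (by fun_prop) fun s hs => ?_)).intervalIntegrable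
            rw [uIcc_of_le hAn.1] at hs
            linarith [hs.2, hAn.2]
          · have := density_radial_le φ hΩc hζ hs.1 (hs.2.trans_lt hAn.2)
            simp only [hf]
            rw [hK, mul_one_div]
            exact this
      _ = K * Real.log (1 / (1 - A (n + 2))) := by
          rw [intervalIntegral.integral_const_mul, integral_inv_one_sub hAn.2]
  -- the Hölder bound at `A (n+2)` controls the logarithm
  have hlogb : Real.log (1 / (1 - A (n + 2))) ≤ (Real.log C' + (n + 2) * Real.log 2) / α := by
    have h1 : (1 : ℝ) / 2 ^ (n + 2) ≤ C' * (1 - A (n + 2)) ^ (α : ℝ) := by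
      rw [← hgn]; exact hrad' _ hAn.1 hAn.2
    have hu : 0 < 1 - A (n + 2) := by linarith [hAn.2]
    rw [le_div_iff₀ hαr, one_div, Real.log_inv]
    -- `-α log(1-A) ≤ log C' + (n+2) log 2` from `h1`
    have h2 : Real.log (1 / 2 ^ (n + 2)) ≤ Real.log (C' * (1 - A (n + 2)) ^ (α : ℝ)) :=
      Real.log_le_log (by positivity) h1
    rw [one_div, Real.log_inv, Real.log_pow, Real.log_mul hC'0.ne' (Real.rpow_pos_of_pos hu _).ne',
      Real.log_rpow hu] at h2
    push_cast at h2 ⊢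
    nlinarith
  -- COUNTING
  have hNP : (NP.card : ℝ) ≤ ((n : ℝ) + 2) / 4 + c₀ := by
    have h1 : (NP.card : ℝ) * (1 / η') ≤ K * ((Real.log C' + (n + 2) * Real.log 2) / α) := by
      calc (NP.card : ℝ) * (1 / η') ≤ _ := hsum1
        _ = _ := hsum2
        _ ≤ _ := hsum3
        _ ≤ _ := hsum4
        _ ≤ K * ((Real.log C' + (n + 2) * Real.log 2) / α) := by gcongr
    rw [mul_one_div, div_le_iff₀ hη'0] at h1
    -- use `η' ≤ α / (4 K log 2)`
    have h2 : K * ((Real.log C' + (n + 2) * Real.log 2) / α) * η' ≤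
        K * ((Real.log C' + (n + 2) * Real.log 2) / α) * ((α : ℝ) / (4 * K * Real.log 2)) := by
      refine mul_le_mul_of_nonneg_left hη'2 ?_
      have : 0 ≤ Real.log C' + (n + 2) * Real.log 2 :=
        add_nonneg (Real.log_nonneg hC'1) (by positivity)
      exact mul_nonneg hK0.le (div_nonneg this hαr.le)
    have h3 : K * ((Real.log C' + (n + 2) * Real.log 2) / α) * ((α : ℝ) / (4 * K * Real.log 2)) =
        ((n : ℝ) + 2) / 4 + c₀ := by
      rw [hc₀]; field_simp; ring
    linarith
  have hIcc : ((Finset.Icc k₁ n).card : ℝ) = n + 1 - k₁ := by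
    rw [Nat.card_Icc]; push_cast [Nat.cast_sub (by omega : k₁ ≤ n + 1)]; ring
  have hP' : (P.card : ℝ) = (n + 1 - k₁) - NP.card := by
    have : (P.card : ℝ) + NP.card = (Finset.Icc k₁ n).card := by exact_mod_cast hcard
    linarith
  have hn₀ : 4 * ((k₁ : ℝ) + c₀) ≤ n := (Nat.le_ceil _).trans (by exact_mod_cast hn)
  show (1 / 2 : ℝ) * n ≤ P.card
  rw [hP']
  linarith

end MeanPorous

end Literature.Probability.RandomPlanarGeometry
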